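import Summits.CriticalPhenomena.Ising3DConformalLimit.Theses.LogPolarProxy
import Summits.CriticalPhenomena.Ising3DConformalLimit.Theorems.ArmHyperscalingMergingFloorGlue
import Summits.CriticalPhenomena.Ising3DConformalLimit.Theorems.ExistsScaleCovariantLimit.Negative.DeltaDetermined
import HarnessLib

/-!
# Split of crux stmt-CriticalPhenomena-0636 `IsingEuclidUpgradeR4NonGaussian` (route LogPolarProxy):
# δ-hyperscaling isotherm ∧ block second-moment floor ⟹ the crux (Newman 1979, Cor. 2.6, in pointwise-limit currency)

Strategist s2 (2026-08-17). The live line `isotherm-saturation-lee-yang` reduces the crux to its stub S1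
`stub_matchedUpperIsotherm` through the landed payer
`ArmHyperscalingMergingFloor.nonGaussian_of_matchedUpperIsotherm`. S1 factors EXACTLY through the two
hypotheses of Newman's 1979 non-Gaussianity criterion (Comm. Math. Phys. 66, Corollary 2.6, (2.25)–(2.26);
Ellis 2006, Theorem V.8.6, (5.47)–(5.48)), re-typed over the tree's declarations with the exponent written
through the scaling dimension `Δ` of the pointwise limit (`1/δ = Δ/(3−Δ)`, `2y_h − 3 = 6 − 2Δ − 3`):

* child 1 `DeltaHyperscalingIsotherm` — the unproved half of the hyperscaling relation for the critical
  isotherm: `m(β_c,h) ≤ A h^{Δ/(3−Δ)}` for `0 < h ≤ h₀` (Fisher 1969 / Buckingham–Gunton 1969 / Newman 1979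
  prove only `δ ≥ (d+2−η)/(d−2+η)`; ABF87's `m ≥ c h^{1/3}` — tree `not_isothermGain_above_third` — makes it
  tight at `Δ = 3/4`; false for `d ≥ 5`);
* child 2 `BlockSecondMomentLower` — the block second moment `Σ_L = ⟨M_L²⟩_{β_c}` carries no vanishing slowly
  varying factor: `Σ_L ≥ c L^{6−2Δ}` eventually (Newman's (2.26) `G(R) ≥ ε R^{2−η}`, "no logarithmic terms").

`matchedUpperIsotherm_of_subs` proves S1 from the two children (real analysis at the matched field
`h_L = C/√Σ_L`: `(2L+1)³ A h_L^θ ≤ ½β_c C √Σ_L` as soon as `C^{1−θ} ≥ 54A/(β_c c^{(1+θ)/2})`, using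
`(6−2Δ)(1+θ)/2 = 3`), and `isingEuclidUpgradeR4NonGaussian_of_subs` composes with the payer to conclude the
crux BY NAME in the LogPolarProxy spelling (all route copies of the decl are syntactically identical). The two
hypotheses are spelled out verbatim (no new `def`s), so the theorem can serve as `--glue-by` for the split
`IsingEuclidUpgradeR4NonGaussian ⟸ DeltaHyperscalingIsotherm ∧ BlockSecondMomentLower`.
-/

namespace Summit.CriticalPhenomena.Ising3DConformalLimit.LogPolarProxyIsingEuclidUpgradeR4NonGaussianSplit

open Literature.Probability.LatticeModels Filter Set Finset
open scoped Topology BigOperators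

/-! ### The scalar core: at the matched field the isotherm bound beats half the linear response -/

/-- Scalar core of the matched-isotherm estimate. With `θ ∈ (0,1)`, `e·(1+θ)/2 = 3`, `Σ ≥ c L^e`,
`C^{1−θ} ≥ 54A/(β c^{(1+θ)/2})` and `m ≤ A (C/√Σ)^θ`: `(2L+1)³ m ≤ ½ β C √Σ`. [folklore] -/
theorem core_estimate {β A C c θ e Sg Lr m : ℝ} (hβ : 0 < β) (hA : 0 < A) (hC : 0 < C) (hc : 0 < c)
    (hθ0 : 0 < θ) (hθ1 : θ < 1) (he : e * ((1 + θ) / 2) = 3) (hSg : 0 < Sg) (hL1 : 1 ≤ Lr)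
    (hKC : 54 * A / (β * c ^ ((1 + θ) / 2)) ≤ C ^ (1 - θ))
    (hlow : c * Lr ^ e ≤ Sg)
    (hm : m ≤ A * (C / Real.sqrt Sg) ^ θ) :
    (2 * Lr + 1) ^ 3 * m ≤ β * C / 2 * Real.sqrt Sg := by
  have hL0 : 0 < Lr := lt_of_lt_of_le one_pos hL1
  set s := Real.sqrt Sg with hs_def
  have hs : 0 < s := Real.sqrt_pos.2 hSg
  set p := (1 + θ) / 2 with hp_def
  have hp0 : 0 < p := by rw [hp_def]; linarith
  have hcp : 0 < c ^ p := Real.rpow_pos_of_pos hc p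
  -- (2L+1)^3 ≤ 27 L^3
  have hcube : (2 * Lr + 1) ^ 3 ≤ 27 * Lr ^ 3 := by
    have : (2 * Lr + 1) ^ 3 ≤ (3 * Lr) ^ 3 :=
      pow_le_pow_left₀ (by linarith) (by linarith) 3
    linarith [this, show (3 * Lr) ^ 3 = 27 * Lr ^ 3 by ring]
  -- the isotherm bound at the matched field
  have hrhs_nonneg : 0 ≤ A * (C / s) ^ θ := by positivity
  have step1 : (2 * Lr + 1) ^ 3 * m ≤ 27 * Lr ^ 3 * (A * (C / s) ^ θ) :=
    calc (2 * Lr + 1) ^ 3 * m ≤ (2 * Lr + 1) ^ 3 * (A * (C / s) ^ θ) :=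
          mul_le_mul_of_nonneg_left hm (by positivity)
      _ ≤ 27 * Lr ^ 3 * (A * (C / s) ^ θ) := mul_le_mul_of_nonneg_right hcube hrhs_nonneg
  -- s^{1+θ} ≥ c^p L^3
  have hs_rpow : s = Sg ^ (1 / 2 : ℝ) := by rw [hs_def, Real.sqrt_eq_rpow]
  have hspow : c ^ p * Lr ^ (3 : ℕ) ≤ s ^ (1 + θ) := by
    have h1 : s ^ (1 + θ) = Sg ^ p := by
      rw [hs_rpow, ← Real.rpow_mul hSg.le, hp_def]; ring_nf
    have h2 : (c * Lr ^ e) ^ p ≤ Sg ^ p :=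
      Real.rpow_le_rpow (by positivity) hlow hp0.le
    have h3 : (c * Lr ^ e) ^ p = c ^ p * Lr ^ (3 : ℕ) := by
      rw [Real.mul_rpow hc.le (Real.rpow_nonneg hL0.le e), ← Real.rpow_mul hL0.le, he]
      norm_cast
    rw [h1, ← h3]; exact h2
  -- C = C^θ · C^{1-θ} and the choice of C
  have hCsplit : C ^ θ * C ^ (1 - θ) = C := by
    rw [← Real.rpow_add hC]; norm_num
  have hCθ : 0 < C ^ θ := Real.rpow_pos_of_pos hC θ
  have hchoice : 54 * A * C ^ θ ≤ β * c ^ p * C := by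
    have h1 : 54 * A ≤ β * c ^ p * C ^ (1 - θ) := by
      have := hKC
      rw [div_le_iff₀ (by positivity)] at this
      linarith [this]
    calc 54 * A * C ^ θ ≤ β * c ^ p * C ^ (1 - θ) * C ^ θ :=
          mul_le_mul_of_nonneg_right h1 hCθ.le
      _ = β * c ^ p * C := by rw [mul_assoc, mul_comm (C ^ (1 - θ)), hCsplit]
  -- assemble: 27 L^3 A (C/s)^θ ≤ β C/2 · s
  have hdiv : (C / s) ^ θ = C ^ θ / s ^ θ := Real.div_rpow hC.le hs.le θ
  have hsθ : 0 < s ^ θ := Real.rpow_pos_of_pos hs θ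
  have hs1θ : s ^ (1 + θ) = s * s ^ θ := by
    rw [Real.rpow_add hs, Real.rpow_one]
  have step2 : 27 * Lr ^ 3 * (A * (C / s) ^ θ) ≤ β * C / 2 * s := by
    rw [hdiv, show 27 * Lr ^ 3 * (A * (C ^ θ / s ^ θ)) = (27 * Lr ^ 3 * A * C ^ θ) / s ^ θ by ring,
      div_le_iff₀ hsθ]
    have hL3 : 0 ≤ Lr ^ 3 := by positivity
    calc 27 * Lr ^ 3 * A * C ^ θ = (Lr ^ 3) * (54 * A * C ^ θ) / 2 := by ring
      _ ≤ (Lr ^ 3) * (β * c ^ p * C) / 2 := by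
          have := mul_le_mul_of_nonneg_left hchoice hL3
          linarith
      _ = β * C / 2 * (c ^ p * Lr ^ (3 : ℕ)) := by ring
      _ ≤ β * C / 2 * s ^ (1 + θ) :=
          mul_le_mul_of_nonneg_left hspow (by positivity)
      _ = β * C / 2 * s * s ^ θ := by rw [hs1θ]; ring
  exact step1.trans step2

/-! ### S1 of the live line from the two children -/

/-- **S1 `stub_matchedUpperIsotherm` of line `isotherm-saturation-lee-yang` from Newman's two hypotheses**
(child 1 = the δ-hyperscaling upper isotherm `m(β_c,h) ≤ A h^{Δ/(3−Δ)}`; child 2 = the block second-moment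
floor `Σ_L ≥ c L^{6−2Δ}`): at the matched field `h_L = C/√Σ_L` one gets `(2L+1)³ m(β_c,h_L) ≤ ½ β_c C √Σ_L`
eventually, for `C` large. [cite: Newman1979, Corollary 2.6] -/
theorem matchedUpperIsotherm_of_subs
    (h1 : ∀ (ρ : ℝ → ℝ) (Δ : ℝ) (S : Literature.Probability.LatticeModels.CorrFamily 3), (∀ δ ∈ Set.Ioc (0:ℝ) 1, 0 < ρ δ) → Literature.Probability.LatticeModels.HasPointwiseScalingLimit (Literature.Probability.LatticeModels.criticalCorr 3) ρ S → Literature.Probability.LatticeModels.IsNondegenerateTwoPoint S → Literature.Probability.LatticeModels.IsScaleCovariant Δ S → ∃ A h₀ : ℝ, 0 < h₀ ∧ ∀ h : ℝ, 0 < h → h ≤ h₀ → Literature.Probability.LatticeModels.magnetizationInField 3 (Literature.Probability.LatticeModels.criticalBeta 3) h ≤ A * h ^ (Δ / (3 - Δ)))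
    (h2 : ∀ (ρ : ℝ → ℝ) (Δ : ℝ) (S : Literature.Probability.LatticeModels.CorrFamily 3), (∀ δ ∈ Set.Ioc (0:ℝ) 1, 0 < ρ δ) → Literature.Probability.LatticeModels.HasPointwiseScalingLimit (Literature.Probability.LatticeModels.criticalCorr 3) ρ S → Literature.Probability.LatticeModels.IsNondegenerateTwoPoint S → Literature.Probability.LatticeModels.IsScaleCovariant Δ S → ∃ c : ℝ, 0 < c ∧ ∀ᶠ L : ℕ in Filter.atTop, c * (L : ℝ) ^ (6 - 2 * Δ) ≤ Literature.Probability.LatticeModels.plusExpect 3 (Literature.Probability.LatticeModels.criticalBeta 3) 0 (fun σ => (∑ x ∈ Literature.Probability.LatticeModels.box 3 L, Literature.Probability.LatticeModels.spinAt x σ) ^ 2)) :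
    ∀ (ρ : ℝ → ℝ) (Δ : ℝ) (S : CorrFamily 3), (∀ δ ∈ Set.Ioc (0:ℝ) 1, 0 < ρ δ) →
      HasPointwiseScalingLimit (criticalCorr 3) ρ S → IsNondegenerateTwoPoint S →
      IsScaleCovariant Δ S →
      ∃ C : ℝ, 0 < C ∧ ∀ᶠ L : ℕ in atTop,
        (2 * (L : ℝ) + 1) ^ 3 * magnetizationInField 3 (criticalBeta 3)
            (C / Real.sqrt (plusExpect 3 (criticalBeta 3) 0 (fun σ => (∑ x ∈ box 3 L, spinAt x σ) ^ 2))) ≤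
          criticalBeta 3 * C / 2 *
            Real.sqrt (plusExpect 3 (criticalBeta 3) 0 (fun σ => (∑ x ∈ box 3 L, spinAt x σ) ^ 2)) := by
  intro ρ Δ S hρ hlim hnd hsc
  obtain ⟨hΔlo, hΔhi⟩ :=
    ExistsScaleCovariantLimitNegative.delta_mem_Icc_of_witness hρ hlim hnd hsc
  obtain ⟨A₀, h₀, hh₀, hiso⟩ := h1 ρ Δ S hρ hlim hnd hsc
  obtain ⟨c, hc, hlow⟩ := h2 ρ Δ S hρ hlim hnd hsc
  have hβ : 0 < criticalBeta 3 := criticalBeta_pos_holds (d := 3) (by norm_num)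
  -- exponents
  set θ : ℝ := Δ / (3 - Δ) with hθ_def
  have h3Δ : 0 < 3 - Δ := by linarith
  have hθ0 : 0 < θ := by rw [hθ_def]; exact div_pos (by linarith) h3Δ
  have hθ1 : θ < 1 := by rw [hθ_def, div_lt_one h3Δ]; linarith
  set e : ℝ := 6 - 2 * Δ with he_def
  have he0 : 0 < e := by rw [he_def]; linarith
  have he : e * ((1 + θ) / 2) = 3 := by
    rw [he_def, hθ_def]; field_simp; ring
  -- a positive amplitude
  set A : ℝ := max A₀ 1 with hA_def
  have hA : 0 < A := lt_of_lt_of_le one_pos (le_max_right _ _)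
  have hiso' : ∀ h : ℝ, 0 < h → h ≤ h₀ →
      magnetizationInField 3 (criticalBeta 3) h ≤ A * h ^ θ := fun h hh hhh =>
    (hiso h hh hhh).trans (mul_le_mul_of_nonneg_right (le_max_left _ _) (Real.rpow_nonneg hh.le _))
  -- the choice of C
  set p : ℝ := (1 + θ) / 2 with hp_def
  set K : ℝ := 54 * A / (criticalBeta 3 * c ^ p) with hK_def
  have hK : 0 < K := by rw [hK_def]; have := Real.rpow_pos_of_pos hc p; positivity
  set C : ℝ := max 1 (K ^ (1 / (1 - θ))) with hC_def
  have hC1 : 1 ≤ C := le_max_left _ _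
  have hC : 0 < C := lt_of_lt_of_le one_pos hC1
  have hKC : K ≤ C ^ (1 - θ) := by
    have h1θ : 0 < 1 - θ := by linarith
    have hle : K ^ (1 / (1 - θ)) ≤ C := le_max_right _ _
    have := Real.rpow_le_rpow (Real.rpow_nonneg hK.le _) hle h1θ.le
    rwa [← Real.rpow_mul hK.le, one_div_mul_cancel h1θ.ne', Real.rpow_one] at this
  refine ⟨C, hC, ?_⟩
  -- eventual validity: L ≥ 1, the second-moment floor, and h_L ≤ h₀
  have hev1 : ∀ᶠ L : ℕ in atTop, (1 : ℝ) ≤ L :=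
    (Filter.eventually_ge_atTop 1).mono fun L hL => by exact_mod_cast hL
  have hev3 : ∀ᶠ L : ℕ in atTop, (C / h₀) ^ 2 ≤ c * (L : ℝ) ^ e := by
    have ht : Tendsto (fun L : ℕ => c * (L : ℝ) ^ e) atTop atTop :=
      Tendsto.const_mul_atTop hc ((tendsto_rpow_atTop he0).comp tendsto_natCast_atTop_atTop)
    exact ht.eventually_ge_atTop _
  filter_upwards [hev1, hlow, hev3] with L hL1 hlowL h3L
  set Sg := plusExpect 3 (criticalBeta 3) 0 (fun σ => (∑ x ∈ box 3 L, spinAt x σ) ^ 2) with hSg_def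
  have hL0 : (0 : ℝ) < L := lt_of_lt_of_le one_pos hL1
  have hSg : 0 < Sg := lt_of_lt_of_le (by positivity) hlowL
  have hs : 0 < Real.sqrt Sg := Real.sqrt_pos.2 hSg
  -- the matched field is admissible
  have hh : 0 < C / Real.sqrt Sg := div_pos hC hs
  have hhh : C / Real.sqrt Sg ≤ h₀ := by
    rw [div_le_iff₀ hs]
    have h2 : (C / h₀) ^ 2 ≤ Sg := h3L.trans hlowL
    have h3 : C / h₀ ≤ Real.sqrt Sg := by
      rw [← Real.sqrt_sq (div_pos hC hh₀).le]
      exact Real.sqrt_le_sqrt h2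
    rw [div_le_iff₀ hh₀] at h3
    linarith [h3, mul_comm h₀ (Real.sqrt Sg)]
  have hm := hiso' _ hh hhh
  have hKC' : 54 * A / (criticalBeta 3 * c ^ ((1 + θ) / 2)) ≤ C ^ (1 - θ) := by rw [← hp_def]; exact hKC
  exact core_estimate hβ hA hC hc hθ0 hθ1 he hSg hL1 hKC' hlowL hm

/-! ### The crux by name -/

/-- **Split glue for item stmt-CriticalPhenomena-0636 on route LogPolarProxy**:
`DeltaHyperscalingIsotherm → BlockSecondMomentLower → LogPolarProxy.IsingEuclidUpgradeR4NonGaussian`, both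
hypotheses spelled out verbatim, via S1 (`matchedUpperIsotherm_of_subs`) and the landed payer
`ArmHyperscalingMergingFloor.nonGaussian_of_matchedUpperIsotherm` (Lee–Yang deficit ⟹ Binder floor ⟹ no
Gaussian limit). This is Newman's 1979 non-Gaussianity criterion (Corollary 2.6: free-energy/isotherm bound
(2.25) with the hyperscaling `δ`, second-moment floor (2.26)) in the pointwise-limit currency, where the
convergence-in-law hypothesis is replaced by the Lee–Yang package of the block law. [cite: Newman1979, Corollary 2.6] -/
theorem isingEuclidUpgradeR4NonGaussian_of_subs
    (h1 : ∀ (ρ : ℝ → ℝ) (Δ : ℝ) (S : Literature.Probability.LatticeModels.CorrFamily 3), (∀ δ ∈ Set.Ioc (0:ℝ) 1, 0 < ρ δ) → Literature.Probability.LatticeModels.HasPointwiseScalingLimit (Literature.Probability.LatticeModels.criticalCorr 3) ρ S → Literature.Probability.LatticeModels.IsNondegenerateTwoPoint S → Literature.Probability.LatticeModels.IsScaleCovariant Δ S → ∃ A h₀ : ℝ, 0 < h₀ ∧ ∀ h : ℝ, 0 < h → h ≤ h₀ → Literature.Probability.LatticeModels.magnetizationInField 3 (Literature.Probability.LatticeModels.criticalBeta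 3) h ≤ A * h ^ (Δ / (3 - Δ)))
    (h2 : ∀ (ρ : ℝ → ℝ) (Δ : ℝ) (S : Literature.Probability.LatticeModels.CorrFamily 3), (∀ δ ∈ Set.Ioc (0:ℝ) 1, 0 < ρ δ) → Literature.Probability.LatticeModels.HasPointwiseScalingLimit (Literature.Probability.LatticeModels.criticalCorr 3) ρ S → Literature.Probability.LatticeModels.IsNondegenerateTwoPoint S → Literature.Probability.LatticeModels.IsScaleCovariant Δ S → ∃ c : ℝ, 0 < c ∧ ∀ᶠ L : ℕ in Filter.atTop, c * (L : ℝ) ^ (6 - 2 * Δ) ≤ Literature.Probability.LatticeModels.plusExpect 3 (Literature.Probability.LatticeModels.criticalBeta 3) 0 (fun σ => (∑ x ∈ Literature.Probability.LatticeModels.box 3 L, Literature.Probability.LatticeModels.spinAt x σ) ^ 2)) :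
    Summit.CriticalPhenomena.Ising3DConformalLimit.Theses.LogPolarProxy.IsingEuclidUpgradeR4NonGaussian :=
  ArmHyperscalingMergingFloor.nonGaussian_of_matchedUpperIsotherm (matchedUpperIsotherm_of_subs h1 h2)

/-- The same glue into the primary `IsingEuclidUpgrade` spelling of the shared decl (item 0636's home route),
for the 31 sibling routes. [cite: Newman1979, Corollary 2.6] -/
theorem isingEuclidUpgrade_nonGaussian_of_subs
    (h1 : ∀ (ρ : ℝ → ℝ) (Δ : ℝ) (S : Literature.Probability.LatticeModels.CorrFamily 3), (∀ δ ∈ Set.Ioc (0:ℝ) 1, 0 < ρ δ) → Literature.Probability.LatticeModels.HasPointwiseScalingLimit (Literature.Probability.LatticeModels.criticalCorr 3) ρ S → Literature.Probability.LatticeModels.IsNondegenerateTwoPoint S → Literature.Probability.LatticeModels.IsScaleCovariant Δ S → ∃ A h₀ : ℝ, 0 < h₀ ∧ ∀ h : ℝ, 0 < h → h ≤ h₀ → Literature.Probability.LatticeModels.magnetizationInField 3 (Literature.Probability.LatticeModels.criticalBeta 3) h ≤ A * h ^ (Δ / (3 - Δ)))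
    (h2 : ∀ (ρ : ℝ → ℝ) (Δ : ℝ) (S : Literature.Probability.LatticeModels.CorrFamily 3), (∀ δ ∈ Set.Ioc (0:ℝ) 1, 0 < ρ δ) → Literature.Probability.LatticeModels.HasPointwiseScalingLimit (Literature.Probability.LatticeModels.criticalCorr 3) ρ S → Literature.Probability.LatticeModels.IsNondegenerateTwoPoint S → Literature.Probability.LatticeModels.IsScaleCovariant Δ S → ∃ c : ℝ, 0 < c ∧ ∀ᶠ L : ℕ in Filter.atTop, c * (L : ℝ) ^ (6 - 2 * Δ) ≤ Literature.Probability.LatticeModels.plusExpect 3 (Literature.Probability.LatticeModels.criticalBeta 3) 0 (fun σ => (∑ x ∈ Literature.Probability.LatticeModels.box 3 L, Literature.Probability.LatticeModels.spinAt x σ) ^ 2)) :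
    Summit.CriticalPhenomena.Ising3DConformalLimit.Theses.IsingEuclidUpgrade.IsingEuclidUpgradeR4NonGaussian :=
  ArmHyperscalingMergingFloor.nonGaussian_of_matchedUpperIsotherm (matchedUpperIsotherm_of_subs h1 h2)

end Summit.CriticalPhenomena.Ising3DConformalLimit.LogPolarProxyIsingEuclidUpgradeR4NonGaussianSplit
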